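import Literature.Computability.Complexity.HardcoreInapproximabilitySecondMomentColour
import Literature.Computability.Complexity.HardcoreInapproximabilityMWWHessian
import HarnessLib

/-!
# The colour quadratic form `Q_B = Q₁ - Q₀` and the expansion of the colour rate

For the Laplace analysis of one matching's factor of the second moment (file `…SecondMomentColour`)
we isolate the `d`-slope of Mossel–Weitz–Wormald's Hessian form: `slyQ d = slyQ 0 + d · Q_B`
(`slyQ_eq_zero_add`), `G = f₁ - f₀` (`slyRate_one_sub_zero`), the coordinates of `Q_B`
(`slyQB_eq`: coefficients `slyB11, slyB22, slyB13, slyB23` and the `ε`-curvature `-slyK3 < 0`), the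
completed square `Q_B(h) = M_B(h₁,h₂) - (κ₃/2)(h₃ - ĥ₃)²` (`slyQB_complete_square`, `slyMB`,
`slyHhat`), and the second-order expansion `|G(c*+h) - Q_B(h)| ≤ 180 s³/m⁴`
(`abs_slyGrate_sub_slyQB_le`, from `abs_slyRate_sub_slyQ_le` at `d = 1, 0`).

## References
* [MosselWeitzWormald2008] E. Mossel, D. Weitz, N. Wormald, PTRF 143 (2009), proof of Theorem 3.3
  (the matrix `H_f`), Lemmas 5.1–5.2, proof of Theorem 6.11 (the Gaussian integral in `ε`).
* [Sly2010] A. Sly, FOCS 2010 / arXiv:1005.5584, §3.2.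
-/

namespace Literature.Computability.Complexity

open Real Finset

section Affine

variable (α β γ δ ε : ℝ)

/-- `G = f₁ - f₀`: the colour rate is the difference of the rates at `d = 1` and `d = 0`. [folklore] -/
theorem slyRate_one_sub_zero :
    slyRate 1 α β γ δ ε - slyRate 0 α β γ δ ε = slyGrate α β γ δ ε := by
  unfold slyRate slyGrate
  push_cast
  ring

/-- `f₀ = f_A` does not depend on `ε`. [folklore] -/
theorem slyRate_zero (ε' : ℝ) : slyRate 0 α β γ δ ε = slyRate 0 α β γ δ ε' := by
  unfold slyRate; push_cast; ring

/-- `f_d = f₀ + d · G`. [folklore] -/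
theorem slyRate_eq_zero_add (d : ℕ) :
    slyRate d α β γ δ ε = slyRate 0 α β γ δ ε + d * slyGrate α β γ δ ε := by
  unfold slyRate slyGrate; push_cast; ring

/-- The Hessian form is affine in `d`: `Q_d = Q₀ + d (Q₁ - Q₀)`. [folklore] -/
theorem slyQ_eq_zero_add (d : ℕ) (h₁ h₂ h₃ : ℝ) :
    slyQ d α β h₁ h₂ h₃ = slyQ 0 α β h₁ h₂ h₃ + d * (slyQ 1 α β h₁ h₂ h₃ - slyQ 0 α β h₁ h₂ h₃) := by
  unfold slyQ; push_cast; ring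

/-- `Q₀` does not depend on `h₃`. [folklore] -/
theorem slyQ_zero_indep (h₁ h₂ h₃ h₃' : ℝ) : slyQ 0 α β h₁ h₂ h₃ = slyQ 0 α β h₁ h₂ h₃' := by
  unfold slyQ; push_cast; ring

end Affine

section QB

variable (α β : ℝ)

/-- **The `ε`-curvature `κ₃ = -h₃₃/d`** of the colour rate at the product point. [cite: MosselWeitzWormald2008, proof of Theorem 3.3 (`h₃₃`)] -/
noncomputable def slyK3 : ℝ := (1 - α - β + 2 * α * β) / (α * β * (1 - α) * (1 - β) * (1 - α - β))

/-- The coefficients `b₁₃ = h₁₃/d`, `b₂₃ = h₂₃/d` of the colour form. [cite: MosselWeitzWormald2008, proof of Theorem 3.3] -/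
noncomputable def slyB13 : ℝ :=
  -(1 - α - 2 * β + 2 * α * β + β ^ 2) / (α * β * (1 - α) * (1 - β) * (1 - α - β))

/-- The coefficient `b₂₃ = b₁₂ = h₂₃/d`. [cite: MosselWeitzWormald2008, proof of Theorem 3.3] -/
noncomputable def slyB23 : ℝ := 1 / (β * (1 - β) * (1 - α - β))

/-- The coefficient `b₁₁` (the `d`-slope of `h₁₁`). [cite: MosselWeitzWormald2008, proof of Theorem 3.3] -/
noncomputable def slyB11 : ℝ :=
  1 / (α * (1 - α) ^ 2) - 1 / (α * β) + 1 / ((1 - α) * (1 - β)) - 1 / (β * (1 - β) * (1 - α - β))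

/-- The coefficient `b₂₂` (the `d`-slope of `h₂₂`). [cite: MosselWeitzWormald2008, proof of Theorem 3.3] -/
noncomputable def slyB22 : ℝ := -α / (β * (1 - β) ^ 2 * (1 - α - β))

/-- **The colour form** `Q_B(h) = Q₁(h) - Q₀(h) = ½ hᵀ (H₁ - H₀) h`. [folklore] -/
noncomputable def slyQB (h₁ h₂ h₃ : ℝ) : ℝ := slyQ 1 α β h₁ h₂ h₃ - slyQ 0 α β h₁ h₂ h₃

/-- The maximiser `ĥ₃(h₁,h₂) = (b₁₃h₁ + b₂₃h₂)/κ₃` of `Q_B` in `h₃`. [folklore] -/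
noncomputable def slyHhat (h₁ h₂ : ℝ) : ℝ := (slyB13 α β * h₁ + slyB23 α β * h₂) / slyK3 α β

/-- The maximum `M_B(h₁,h₂) = max_{h₃} Q_B(h)` of the colour form. [folklore] -/
noncomputable def slyMB (h₁ h₂ : ℝ) : ℝ :=
  (slyB13 α β * h₁ + slyB23 α β * h₂) ^ 2 / (2 * slyK3 α β) +
    (slyB11 α β * h₁ ^ 2 + slyB22 α β * h₂ ^ 2 + 2 * slyB23 α β * h₁ * h₂) / 2

variable {α β}

/-- `κ₃ > 0` on the open simplex. [folklore] -/
theorem slyK3_pos (hα : 0 < α) (hβ : 0 < β) (hαβ : α + β < 1) : 0 < slyK3 α β := by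
  unfold slyK3
  have h1 : 0 < 1 - α := by linarith
  have h2 : 0 < 1 - β := by linarith
  have h3 : 0 < 1 - α - β := by linarith
  have : 0 < 1 - α - β + 2 * α * β := by positivity
  positivity

set_option maxHeartbeats 4000000 in
/-- **The colour form in coordinates.** [folklore] -/
theorem slyQB_eq (hα : 0 < α) (hβ : 0 < β) (hαβ : α + β < 1) (h₁ h₂ h₃ : ℝ) :
    slyQB α β h₁ h₂ h₃ =
      (slyB11 α β * h₁ ^ 2 + slyB22 α β * h₂ ^ 2 - slyK3 α β * h₃ ^ 2 +
        2 * slyB23 α β * h₁ * h₂ + 2 * slyB13 α β * h₁ * h₃ + 2 * slyB23 α β * h₂ * h₃) / 2 := by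
  have h1 : (1 - α) ≠ 0 := by intro h; linarith
  have h1' : (α - 1) ≠ 0 := by intro h; linarith
  have h2 : (1 - β) ≠ 0 := by intro h; linarith
  have h3 : (1 - α - β) ≠ 0 := by intro h; linarith
  have hα' : α ≠ 0 := hα.ne'
  have hβ' : β ≠ 0 := hβ.ne'
  unfold slyQB slyQ slyB11 slyB22 slyK3 slyB23 slyB13
  push_cast
  field_simp
  ring

/-- **Completing the square in `ε`**: `Q_B(h) = M_B(h₁,h₂) - (κ₃/2)(h₃ - ĥ₃(h₁,h₂))²`. [folklore] -/
theorem slyQB_complete_square (hα : 0 < α) (hβ : 0 < β) (hαβ : α + β < 1) (h₁ h₂ h₃ : ℝ) :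
    slyQB α β h₁ h₂ h₃ =
      slyMB α β h₁ h₂ - slyK3 α β / 2 * (h₃ - slyHhat α β h₁ h₂) ^ 2 := by
  rw [slyQB_eq hα hβ hαβ]
  have hK := (slyK3_pos hα hβ hαβ).ne'
  unfold slyMB slyHhat
  field_simp
  ring

/-- `Q_B ≤ M_B`. [folklore] -/
theorem slyQB_le_slyMB (hα : 0 < α) (hβ : 0 < β) (hαβ : α + β < 1) (h₁ h₂ h₃ : ℝ) :
    slyQB α β h₁ h₂ h₃ ≤ slyMB α β h₁ h₂ := by
  rw [slyQB_complete_square hα hβ hαβ]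
  have := slyK3_pos hα hβ hαβ
  nlinarith [sq_nonneg (h₃ - slyHhat α β h₁ h₂)]

end QB

section Taylor

variable {α β : ℝ}

/-- **Second-order expansion of the colour rate at the product point**:
`|G(c* + h) - Q_B(h)| ≤ 180 s³/m⁴` for `s = |h₁|+|h₂|+|h₃| ≤ m²/2`, `m = min(α,β,1-α-β)`
(the expansions of `f₁` and `f₀`). [cite: MosselWeitzWormald2008, Lemmas 5.1–5.2 and proof of Theorem 6.11] -/
theorem abs_slyGrate_sub_slyQB_le (hα : 0 < α) (hβ : 0 < β) (hαβ : α + β < 1)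
    {h₁ h₂ h₃ m s : ℝ} (hm : m = min (min α β) (1 - α - β)) (hsd : s = |h₁| + |h₂| + |h₃|)
    (hs : s ≤ m ^ 2 / 2) :
    |slyGrate α β (α ^ 2 + h₁) (β ^ 2 + h₂) (α * (1 - α - β) + h₃) - slyQB α β h₁ h₂ h₃| ≤
      180 * (s ^ 3 / m ^ 4) := by
  have e1 := abs_slyRate_sub_slyQ_le 1 hα hβ hαβ hm hsd hs
  have e0 := abs_slyRate_sub_slyQ_le 0 hα hβ hαβ hm hsd hs
  rw [← slyRate_one_sub_zero]
  unfold slyQB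
  have hmpos : 0 < m := by rw [hm]; exact lt_min (lt_min hα hβ) (by linarith)
  have hs0 : 0 ≤ s := by rw [hsd]; positivity
  have hq : (0 : ℝ) ≤ s ^ 3 / m ^ 4 := by positivity
  rw [abs_le] at e1 e0 ⊢
  push_cast at e1 e0
  constructor
  · nlinarith [e1.1, e0.2, hq]
  · nlinarith [e1.2, e0.1, hq]

end Taylor

section PrefLipschitz

/-- `|log u - log v| ≤ |u - v|/m₀` for `u, v ≥ m₀ > 0`. [folklore] -/
private theorem abs_log_sub_log_le_div {u v m₀ : ℝ} (hm : 0 < m₀) (hu : m₀ ≤ u) (hv : m₀ ≤ v) :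
    |Real.log u - Real.log v| ≤ |u - v| / m₀ := by
  have hu0 : 0 < u := lt_of_lt_of_le hm hu
  have hv0 : 0 < v := lt_of_lt_of_le hm hv
  rw [abs_le]
  constructor
  · -- `log v - log u ≤ (v - u)/u ≤ |u - v|/m₀`
    have h1 : Real.log v - Real.log u ≤ (v - u) / u := by
      rw [← Real.log_div hv0.ne' hu0.ne']
      have := Real.log_le_sub_one_of_pos (div_pos hv0 hu0)
      rw [div_sub_one hu0.ne'] at this
      exact this
    have h2 : (v - u) / u ≤ |u - v| / m₀ := by
      rw [div_le_div_iff₀ hu0 hm]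
      have := le_abs_self (v - u)
      rw [abs_sub_comm] at this
      nlinarith [abs_nonneg (u - v)]
    linarith
  · have h1 : Real.log u - Real.log v ≤ (u - v) / v := by
      rw [← Real.log_div hu0.ne' hv0.ne']
      have := Real.log_le_sub_one_of_pos (div_pos hu0 hv0)
      rw [div_sub_one hv0.ne'] at this
      exact this
    have h2 : (u - v) / v ≤ |u - v| / m₀ := by
      rw [div_le_div_iff₀ hv0 hm]
      nlinarith [le_abs_self (u - v), abs_nonneg (u - v)]
    linarith

/-- The thirteen affine cell densities entering the colour prefactor. [folklore] -/
def slyCells (α β γ δ ε : ℝ) : List ℝ :=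
  [γ, ε, 1 - 2 * β + δ, 1 - 2 * β + δ - γ, 1 - 2 * β + δ - γ - ε, β - δ, α - γ - ε,
    β - δ - (α - γ - ε), 1 - β - γ - ε, α - γ, 1 - β - γ - ε - (α - γ), 1 - γ, 1 - α - (α - γ)]

set_option maxHeartbeats 1600000 in
/-- **The colour prefactor is Lipschitz away from the walls**: if all cell densities are at least
`m₀` at `c` and at `c'`, then `|Pref_B(c) - Pref_B(c')| ≤ 19 (‖c - c'‖₁ / m₀)`. [folklore] -/
theorem abs_slyPrefB_sub_le {α β γ δ ε γ' δ' ε' m₀ : ℝ} (hm : 0 < m₀)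
    (hc : ∀ u ∈ slyCells α β γ δ ε, m₀ ≤ u) (hc' : ∀ u ∈ slyCells α β γ' δ' ε', m₀ ≤ u) :
    |slyPrefB α β γ δ ε - slyPrefB α β γ' δ' ε'| ≤
      19 * ((|γ - γ'| + |δ - δ'| + |ε - ε'|) / m₀) := by
  set D := |γ - γ'| + |δ - δ'| + |ε - ε'| with hD
  have hD0 : 0 ≤ D := by positivity
  -- the log differences, one for each non-constant cell
  have L : ∀ {u v : ℝ}, m₀ ≤ u → m₀ ≤ v → |u - v| ≤ D →
      |Real.log u - Real.log v| ≤ D / m₀ := by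
    intro u v hu hv huv
    exact le_trans (abs_log_sub_log_le_div hm hu hv) (div_le_div_of_nonneg_right huv hm.le)
  have m1 := hc γ (by simp [slyCells]); have m1' := hc' γ' (by simp [slyCells])
  have m2 := hc ε (by simp [slyCells]); have m2' := hc' ε' (by simp [slyCells])
  have m3 := hc (1 - 2 * β + δ) (by simp [slyCells]); have m3' := hc' (1 - 2 * β + δ') (by simp [slyCells])
  have m4 := hc (1 - 2 * β + δ - γ) (by simp [slyCells])
  have m4' := hc' (1 - 2 * β + δ' - γ') (by simp [slyCells])
  have m5 := hc (1 - 2 * β + δ - γ - ε) (by simp [slyCells])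
  have m5' := hc' (1 - 2 * β + δ' - γ' - ε') (by simp [slyCells])
  have m6 := hc (β - δ) (by simp [slyCells]); have m6' := hc' (β - δ') (by simp [slyCells])
  have m7 := hc (α - γ - ε) (by simp [slyCells]); have m7' := hc' (α - γ' - ε') (by simp [slyCells])
  have m8 := hc (β - δ - (α - γ - ε)) (by simp [slyCells])
  have m8' := hc' (β - δ' - (α - γ' - ε')) (by simp [slyCells])
  have m9 := hc (1 - β - γ - ε) (by simp [slyCells])
  have m9' := hc' (1 - β - γ' - ε') (by simp [slyCells])
  have m10 := hc (α - γ) (by simp [slyCells]); have m10' := hc' (α - γ') (by simp [slyCells])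
  have m11 := hc (1 - β - γ - ε - (α - γ)) (by simp [slyCells])
  have m11' := hc' (1 - β - γ' - ε' - (α - γ')) (by simp [slyCells])
  have m12 := hc (1 - γ) (by simp [slyCells]); have m12' := hc' (1 - γ') (by simp [slyCells])
  have m13 := hc (1 - α - (α - γ)) (by simp [slyCells])
  have m13' := hc' (1 - α - (α - γ')) (by simp [slyCells])
  have a1 : |γ - γ'| ≤ D := by rw [hD]; linarith [abs_nonneg (δ - δ'), abs_nonneg (ε - ε')]
  have a2 : |δ - δ'| ≤ D := by rw [hD]; linarith [abs_nonneg (γ - γ'), abs_nonneg (ε - ε')]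
  have a3 : |ε - ε'| ≤ D := by rw [hD]; linarith [abs_nonneg (γ - γ'), abs_nonneg (δ - δ')]
  have g1 := le_abs_self (γ - γ'); have g2 := neg_abs_le (γ - γ')
  have g3 := le_abs_self (δ - δ'); have g4 := neg_abs_le (δ - δ')
  have g5 := le_abs_self (ε - ε'); have g6 := neg_abs_le (ε - ε')
  have T1 := abs_le.mp (L m1 m1' a1)
  have T2 := abs_le.mp (L m2 m2' a3)
  have T3 := abs_le.mp (L m3 m3' (by rw [abs_le]; constructor <;> linarith))
  have T4 := abs_le.mp (L m4 m4' (by rw [abs_le]; constructor <;> linarith))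
  have T5 := abs_le.mp (L m5 m5' (by rw [abs_le]; constructor <;> linarith))
  have T6 := abs_le.mp (L m6 m6' (by rw [abs_le]; constructor <;> linarith))
  have T7 := abs_le.mp (L m7 m7' (by rw [abs_le]; constructor <;> linarith))
  have T8 := abs_le.mp (L m8 m8' (by rw [abs_le]; constructor <;> linarith))
  have T9 := abs_le.mp (L m9 m9' (by rw [abs_le]; constructor <;> linarith))
  have T10 := abs_le.mp (L m10 m10' (by rw [abs_le]; constructor <;> linarith))
  have T11 := abs_le.mp (L m11 m11' (by rw [abs_le]; constructor <;> linarith))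
  have T12 := abs_le.mp (L m12 m12' (by rw [abs_le]; constructor <;> linarith))
  have T13 := abs_le.mp (L m13 m13' (by rw [abs_le]; constructor <;> linarith))
  have T14 := abs_le.mp (L (u := 1 - γ - (α - γ)) (v := 1 - γ' - (α - γ')) (by linarith)
    (by linarith) (by rw [abs_le]; constructor <;> linarith))
  have hDm : 0 ≤ D / m₀ := by positivity
  unfold slyPrefB
  rw [abs_le]
  constructor
  · linarith [T1.1, T1.2, T2.1, T2.2, T3.1, T3.2, T4.1, T4.2, T5.1, T5.2, T6.1, T6.2, T7.1, T7.2,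
      T8.1, T8.2, T9.1, T9.2, T10.1, T10.2, T11.1, T11.2, T12.1, T12.2, T13.1, T13.2, T14.1,
      T14.2, hDm]
  · linarith [T1.1, T1.2, T2.1, T2.2, T3.1, T3.2, T4.1, T4.2, T5.1, T5.2, T6.1, T6.2, T7.1, T7.2,
      T8.1, T8.2, T9.1, T9.2, T10.1, T10.2, T11.1, T11.2, T12.1, T12.2, T13.1, T13.2, T14.1,
      T14.2, hDm]

end PrefLipschitz

end Literature.Computability.Complexity
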